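import Summits.Langlands.Langlands.Theorems.SoloInformedGLOneSatakeRigidity
import Literature.NumberTheory.Automorphic.ClozelAlgebraicityRankOne
import Literature.NumberTheory.Automorphic.GLnAdelicStructureProofs
import Literature.NumberTheory.GaloisRepresentations.CMTypeHeckeCharacter
import Literature.FieldTheory.AlgClosed.PadicAlgClEquivComplex
import HarnessLib

/-!
# The summit on the Tate family of `GL_1`: `Langlands` implies that the PINNED Fontaine datum
# declares every `χ_ℓ^k|Γ_{K_v}` de Rham (rung Λ17)

Programme `solo-Langlands-informed` (statement analysis of `Summit.Langlands`).  Rung Λ16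
(`SoloInformedGLOneSatakeRigidity`) showed that on `GL_1` the summit's unramified clause alone pins the Galois
partner of `π_{‖·‖^k} = ℂ·‖det‖^k/⊥` to `χ_ℓ^k = 𝟙 ⊗ tateChar K ℓ k`.  This file feeds the genuine term
`π_{‖·‖^k}` INTO the summit's direction (A) `AutomorphicToGalois 1 𝓡 hcpt` — it is an L-algebraic cuspidal
automorphic representation of `GL_1(𝔸_K)` (§1) — and reads off what the summit then asserts about tree objects:

* §1 ★ `isLAlgebraic_of_hasInfinityType_heckeCharacter_glOne`: an automorphic representation of `GL_1(𝔸_K)` whose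
  Hecke character has an (integral) infinity type `(p, q)` is L-algebraic — its infinity type (tree
  `AutomorphicRepData.exists_hasInfinityType_of_hasInfinityType_heckeCharacter_glOne`, Clozel 1990 §3.3 for `n = 1`)
  has `a`-exponents `-n_σ` and, by well-formedness, `b`-exponents `-n_σ̄`, all integers; ★
  `exists_cuspidal_normPow_isLAlgebraic`: `π_{‖·‖^k}` is an L-algebraic CUSPIDAL datum (tree
  `exists_cuspidal_detTwist_glOne`, `heckeCharacter_detTwist_glOne`, `hasInfinityType_normCharacter'`).
* §2 ★★★ `automorphicToGalois_one_normPow`: for every reciprocity datum `𝓡`, (A) for `GL_1` implies, for every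
  `ℓ`, `ι`, `k`, that `χ_ℓ^k` is geometric for `𝓡` (`IsGeometricFramed 𝓡 χ_ℓ^k`) and `Corresponds 𝓡 ι π_{‖·‖^k} χ_ℓ^k`
  (in particular `LocalGlobalCompatibleAt 𝓡 ι π_{‖·‖^k} χ_ℓ^k v` at EVERY finite `v`): (A) produces some `ρ`, and
  Λ16 `eq_twist_tateChar_of_corresponds_normPow` forces `ρ = χ_ℓ^k`.  Since `𝓡.pst ℓ v hv` is by definition the
  PINNED datum `fontainePstAdicCompletion v ℓ hv` (Statement, `ReciprocityData.pst`), ★★★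
  `isDeRhamFramed_tateChar_of_automorphicToGalois`: (A) for `GL_1` (any `𝓡`) implies
  `(fontainePstAdicCompletion v ℓ hv).IsDeRhamFramed (𝟙 ⊗ tateChar (K_v) ℓ k)` for every `ℓ`, every `v ∣ ℓ` and
  every `k` (local form by Λ13 `toLocal_twist_tateChar`, Λ12 `toLocal_one`).
* §3 ★★★★ `isDeRhamFramed_tateChar_of_langlands`: the summit `Langlands` itself implies, for EVERY number field
  `K`, prime `ℓ`, place `v ∣ ℓ` and `k : ℕ`, that Fontaine's pinned `p`-adic Hodge datum at `K_v` declares the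
  `k`-th power of the local cyclotomic character de Rham (`hcpt` discharged by the tree theorem
  `isCompact_glFiniteIntegralLevel_holds`, `𝓡` by the summit's `Nonempty (ReciprocityData K)` conjunct, `ι` by
  `PadicAlgCl.nonempty_ringEquiv_complex`); and `corresponds_normPow_tateChar_of_langlands`: for every `𝓡` the
  summit makes `(π_{‖·‖^k}, χ_ℓ^k)` correspond AT EVERY PLACE for `𝓡.llc`.
  This is an ABSOLUTE necessary condition of the typed summit on a tree-constructed object: de Rham-ness of a
  RAMIFIED character is not among the axioms of `PstWeilDeligneData` (only `isDeRhamWith_of_isLocallyUnramified`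
  is), so whether `fontainePstAdicCompletion` satisfies it is a property of the tree's `B_dR` model — the next
  concrete test of the statement (programme note T-dR).

No new definitions; no hypotheses beyond the data.

References: Clozel, in *Automorphic forms, Shimura varieties, and L-functions* I (1990), §1.1, §3.3; Weil (1956),
§1; Buzzard–Gee, LMS LNS 414 (2014), Def. 3.1.1, Conj. 3.2.1, 3.2.2; Fontaine–Mazur (1995), §1 and Conj. 1;
Fontaine, Astérisque 223 (1994), Exp. III §1.5, Exp. VIII §2.3.7; Serre (1968), Ch. II §2.3, Ch. I §1.2;
Borel–Jacquet (1979), 4.4–4.6.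
-/

noncomputable section

open scoped MatrixGroups Matrix Classical Polynomial NumberField
open NumberField IsDedekindDomain Field Polynomial Filter
open Literature.NumberTheory.Automorphic Literature.NumberTheory.GaloisRepresentations

namespace Summit.Langlands.Langlands.Theorems

namespace GLOneRigidity

/-! ### §1 `π_{‖·‖^k}` is an L-algebraic cuspidal automorphic representation of `GL_1(𝔸_K)` -/

section LAlgebraic

variable {K : Type} [Field K] [NumberField K] {hcpt : isCompact_glFiniteIntegralLevel 1 K}

/-- ★ **A `GL_1` automorphic representation with an algebraic Hecke character is L-algebraic.**  If every `g`
acts on `π.W / π.W'` by `θ(det g)` and `θ` has infinity type `(p, q)` (`p, q : InfinitePlace K → ℤ`), then `π` is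
L-algebraic: the tree's infinity type of `π` (Clozel 1990 §3.3, `n = 1`) has `a`-multiset `{-n_σ}` at `σ`, and by
well-formedness (`T σ̄ = (T σ).map swap`) its `b`-exponents are the `a`-exponents at `σ̄`, all integers.
[cite: Clozel1990, §3.3] [cite: BuzzardGee2014, Definition 3.1.1 and Definition 5.3.2] -/
theorem isLAlgebraic_of_hasInfinityType_heckeCharacter_glOne
    (π : AutomorphicRepData (AutomorphyDatum.gl 1 K hcpt)) {θ : HeckeCharacter K}
    (hχ : ∀ (g : (AdelicGroupData.gl 1 K).Adelic), ∀ φ ∈ π.W,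
      rightTranslation (AdelicGroupData.gl 1 K) g φ -
        ((θ (Matrix.GeneralLinearGroup.det g) : ℂˣ) : ℂ) • φ ∈ π.W')
    {p q : InfinitePlace K → ℤ} (hθ : θ.HasInfinityType p q) : π.IsLAlgebraic := by
  obtain ⟨T, hT, ha⟩ := π.exists_hasInfinityType_of_hasInfinityType_heckeCharacter_glOne hχ hθ
  refine ⟨T, hT, fun σ w hw => ?_⟩
  have h1 : w.a = -((HeckeCharacter.embExponent p q σ : ℤ) : ℂ) := by
    have hm : w.a ∈ (T σ).map ArchWeight.a := Multiset.mem_map_of_mem _ hw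
    rw [ha σ, Multiset.mem_singleton] at hm
    exact hm
  have h2 : w.b = -((HeckeCharacter.embExponent p q (ComplexEmbedding.conjugate σ) : ℤ) : ℂ) := by
    have hsw : w.swap ∈ T (ComplexEmbedding.conjugate σ) := by
      rw [hT.1.2 σ]
      exact Multiset.mem_map_of_mem _ hw
    have hm : w.swap.a ∈ (T (ComplexEmbedding.conjugate σ)).map ArchWeight.a := Multiset.mem_map_of_mem _ hsw
    rw [ha, Multiset.mem_singleton, ArchWeight.swap_a] at hm
    exact hm
  exact ⟨-HeckeCharacter.embExponent p q σ, -HeckeCharacter.embExponent p q (ComplexEmbedding.conjugate σ),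
    by rw [h1, Int.cast_neg], by rw [h2, Int.cast_neg]⟩

end LAlgebraic

section NormPow

variable {K : Type} [Field K] [NumberField K]

/-- ★ **`π_{‖·‖^k} = ℂ·‖det‖^k/⊥` is an L-algebraic cuspidal automorphic representation of `GL_1(𝔸_K)`** (Borel–Jacquet
datum `exists_cuspidal_detTwist_glOne`; Hecke character `‖·‖^k` by `heckeCharacter_detTwist_glOne`; infinity type of
`‖·‖` by `hasInfinityType_normCharacter'`, of its powers by `HasInfinityType.zpow'`).
[cite: BorelJacquet1979, 4.6] [cite: SerreAbelianLadic1968, Ch. II §2.3] [cite: BuzzardGee2014, Definition 3.1.1 and Definition 5.3.2] -/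
theorem exists_cuspidal_normPow_isLAlgebraic (hcpt : isCompact_glFiniteIntegralLevel 1 K) (k : ℕ) :
    ∃ π : CuspidalAutomorphicRepData 1 K hcpt,
      π.1.W = Submodule.span ℂ
          {fun g : (AdelicGroupData.gl 1 K).Adelic => (detTwist 1 (HeckeCharacter.normCharacter K ^ k) g : ℂ)} ∧
        π.1.W' = ⊥ ∧ π.1.IsLAlgebraic := by
  obtain ⟨π, hW, hW'⟩ := exists_cuspidal_detTwist_glOne hcpt (HeckeCharacter.normCharacter K ^ k)
  have hθ := (HeckeCharacter.hasInfinityType_normCharacter' (K := K)).zpow' (k : ℤ)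
  rw [zpow_natCast] at hθ
  exact ⟨π, hW, hW', isLAlgebraic_of_hasInfinityType_heckeCharacter_glOne π.1
    (heckeCharacter_detTwist_glOne hW) hθ⟩

/-! ### §2 Direction (A) for `GL_1`, evaluated on the Tate family -/

/-- ★★★ **(A) for `GL_1` forces `χ_ℓ^k` to be geometric and to correspond to `π_{‖·‖^k}` at every place.**  For every
reciprocity datum `𝓡`: if `AutomorphicToGalois 1 𝓡 hcpt`, then for every `ℓ`, `ι`, `k` the L-algebraic cuspidal
`π_{‖·‖^k}` (§1) has `χ_ℓ^k = 𝟙 ⊗ tateChar K ℓ k` as a geometric partner with `Corresponds 𝓡 ι π χ_ℓ^k` — (A)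
provides some partner `ρ`, and Λ16 `eq_twist_tateChar_of_corresponds_normPow` gives `ρ = χ_ℓ^k`.
[cite: BuzzardGeeLMS2014, Conj. 3.2.1 and Conj. 3.2.2] [cite: FontaineMazurGeometric1995, §1] -/
theorem automorphicToGalois_one_normPow {hcpt : isCompact_glFiniteIntegralLevel 1 K} (𝓡 : ReciprocityData K)
    (hA : AutomorphicToGalois 1 𝓡 hcpt) {ℓ : ℕ} [Fact ℓ.Prime] (ι : PadicAlgCl ℓ ≃+* ℂ) (k : ℕ) :
    ∃ π : CuspidalAutomorphicRepData 1 K hcpt,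
      π.1.W = Submodule.span ℂ
          {fun g : (AdelicGroupData.gl 1 K).Adelic => (detTwist 1 (HeckeCharacter.normCharacter K ^ k) g : ℂ)} ∧
        π.1.W' = ⊥ ∧
        IsGeometricFramed 𝓡 (FramedRep.twist (1 : FramedGaloisRep K (PadicAlgCl ℓ) 1) (D2Cris.tateChar K ℓ k)) ∧
        Corresponds 𝓡 ι π.1 (FramedRep.twist (1 : FramedGaloisRep K (PadicAlgCl ℓ) 1) (D2Cris.tateChar K ℓ k)) := by
  obtain ⟨π, hW, hW', halg⟩ := exists_cuspidal_normPow_isLAlgebraic hcpt k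
  obtain ⟨ρ, -, hg, hc, -⟩ := hA π halg ℓ ι
  obtain rfl := eq_twist_tateChar_of_corresponds_normPow 𝓡 ι k hW hW' hc
  exact ⟨π, hW, hW', hg, hc⟩

/-- ★★★ **(A) for `GL_1` forces the PINNED Fontaine datum to declare every `χ_ℓ^k|Γ_{K_v}` de Rham.**  For every
`𝓡` with `AutomorphicToGalois 1 𝓡 hcpt`, every prime `ℓ`, every `v ∣ ℓ` and every `k`:
`(fontainePstAdicCompletion v ℓ hv).IsDeRhamFramed (𝟙 ⊗ tateChar (K_v) ℓ k)` — the geometricity conjunct of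
`automorphicToGalois_one_normPow` at `v`, with `𝓡.pst ℓ v hv = fontainePstAdicCompletion v ℓ hv` by definition
(Statement) and `χ_ℓ^k|Γ_{K_v} = 𝟙 ⊗ tateChar (K_v) ℓ k` (Λ13 `toLocal_twist_tateChar`, Λ12 `toLocal_one`).
[cite: FontaineMazurGeometric1995, §1] [cite: FontaineAsterisque223III, §1.5 and §3] -/
theorem isDeRhamFramed_tateChar_of_automorphicToGalois {hcpt : isCompact_glFiniteIntegralLevel 1 K}
    (𝓡 : ReciprocityData K) (hA : AutomorphicToGalois 1 𝓡 hcpt) (ℓ : ℕ) [Fact ℓ.Prime]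
    (v : HeightOneSpectrum (𝓞 K)) (hv : ((ℓ : ℕ) : 𝓞 K) ∈ v.asIdeal) (k : ℕ) :
    (Literature.NumberTheory.PAdicHodge.fontainePstAdicCompletion v ℓ hv).IsDeRhamFramed
      (FramedRep.twist (1 : FramedGaloisRep (v.adicCompletion K) (PadicAlgCl ℓ) 1)
        (D2Cris.tateChar (v.adicCompletion K) ℓ k)) := by
  obtain ⟨ι⟩ := PadicAlgCl.nonempty_ringEquiv_complex ℓ
  obtain ⟨π, -, -, hg, -⟩ := automorphicToGalois_one_normPow 𝓡 hA ι k
  have h := hg.2 v hv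
  rw [D2Cris.toLocal_twist_tateChar, D2Cris.toLocal_one] at h
  exact h

/-! ### §3 The summit itself -/

/-- ★★★★ **An absolute necessary condition of the typed summit.**  `Langlands` implies: for EVERY number field `K`,
EVERY prime `ℓ`, EVERY place `v ∣ ℓ` of `K` and EVERY `k : ℕ`, Fontaine's pinned `p`-adic Hodge datum at `K_v`
(`fontainePstAdicCompletion v ℓ hv`, the value of `𝓡.pst` for every `𝓡`) declares the `k`-th power of the local
cyclotomic character `𝟙 ⊗ tateChar (K_v) ℓ k : Γ_{K_v} →ₜ* GL_1(ℚ̄_ℓ)` de Rham.  (`hcpt` is the tree theorem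
`isCompact_glFiniteIntegralLevel_holds 1 K`; some `𝓡` exists by the summit's first conjunct.)  De Rham-ness of a
ramified character is NOT an axiom of `PstWeilDeligneData`; this is a property the typed summit demands of the
tree's `B_dR` model.
[cite: FontaineMazurGeometric1995, Conj. 1] [cite: BuzzardGeeLMS2014, Conj. 3.2.1 and Conj. 3.2.2] -/
theorem isDeRhamFramed_tateChar_of_langlands (h : _root_.Langlands) (K : Type) [Field K] [NumberField K]
    (ℓ : ℕ) [Fact ℓ.Prime] (v : HeightOneSpectrum (𝓞 K)) (hv : ((ℓ : ℕ) : 𝓞 K) ∈ v.asIdeal) (k : ℕ) :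
    (Literature.NumberTheory.PAdicHodge.fontainePstAdicCompletion v ℓ hv).IsDeRhamFramed
      (FramedRep.twist (1 : FramedGaloisRep (v.adicCompletion K) (PadicAlgCl ℓ) 1)
        (D2Cris.tateChar (v.adicCompletion K) ℓ k)) := by
  obtain ⟨⟨𝓡⟩, hR⟩ := h K
  exact isDeRhamFramed_tateChar_of_automorphicToGalois 𝓡
    (hR 𝓡 1 one_pos (isCompact_glFiniteIntegralLevel_holds 1 K)).1 ℓ v hv k

/-- ★★★ **The summit makes `(π_{‖·‖^k}, χ_ℓ^k)` correspond at EVERY place, for every reciprocity datum.**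
`Langlands` implies: for every `K`, every `𝓡 : ReciprocityData K`, every `ℓ`, `ι`, `k`, the L-algebraic cuspidal
`π_{‖·‖^k}` and `χ_ℓ^k` satisfy `Corresponds 𝓡 ι π χ_ℓ^k` — in particular `LocalGlobalCompatibleAt 𝓡 ι π χ_ℓ^k v`
at every finite `v` (`𝓡.llc v` matches `π_v` with `WD(χ_ℓ^k|Γ_{K_v})^{F-ss}` as computed by `𝓡.pst`) — and
`χ_ℓ^k` is geometric for `𝓡`.
[cite: BuzzardGeeLMS2014, Conj. 3.2.1 and Conj. 3.2.2] [cite: FontaineMazurGeometric1995, Conj. 1] -/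
theorem corresponds_normPow_tateChar_of_langlands (h : _root_.Langlands) (K : Type) [Field K] [NumberField K]
    (𝓡 : ReciprocityData K) (ℓ : ℕ) [Fact ℓ.Prime] (ι : PadicAlgCl ℓ ≃+* ℂ) (k : ℕ) :
    ∃ π : CuspidalAutomorphicRepData 1 K (isCompact_glFiniteIntegralLevel_holds 1 K),
      π.1.W = Submodule.span ℂ
          {fun g : (AdelicGroupData.gl 1 K).Adelic => (detTwist 1 (HeckeCharacter.normCharacter K ^ k) g : ℂ)} ∧
        π.1.W' = ⊥ ∧ π.1.IsLAlgebraic ∧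
        IsGeometricFramed 𝓡 (FramedRep.twist (1 : FramedGaloisRep K (PadicAlgCl ℓ) 1) (D2Cris.tateChar K ℓ k)) ∧
        Corresponds 𝓡 ι π.1 (FramedRep.twist (1 : FramedGaloisRep K (PadicAlgCl ℓ) 1) (D2Cris.tateChar K ℓ k)) := by
  have hA := ((h K).2 𝓡 1 one_pos (isCompact_glFiniteIntegralLevel_holds 1 K)).1
  obtain ⟨π, hW, hW', halg⟩ := exists_cuspidal_normPow_isLAlgebraic (isCompact_glFiniteIntegralLevel_holds 1 K) k
  obtain ⟨ρ, -, hg, hc, -⟩ := hA π halg ℓ ι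
  obtain rfl := eq_twist_tateChar_of_corresponds_normPow 𝓡 ι k hW hW' hc
  exact ⟨π, hW, hW', halg, hg, hc⟩

end NormPow

end GLOneRigidity

end Summit.Langlands.Langlands.Theorems

end
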